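import Literature.NumberTheory.EllipticCurves.GreenbergSelmerCofreeReductionPkProofs
import Literature.NumberTheory.EllipticCurves.GreenbergSelmerCofreeTorsionGaloisModule
import Literature.NumberTheory.EllipticCurves.SharpFlatPAdicLFunctionCoeffField
import Mathlib.RingTheory.RootsOfUnity.AlgebraicallyClosed
import HarnessLib

/-!
# The self-duality tower `e_k : A_ρ[p^k] × A_ρ[p^k] → μ_{p^k}` of a rank-two framed `𝒪`-representation with `det ρ = ε` (PIN-SPEC-S2 D3 data, K-a)

Route `ResidualThetaTransportAtTwo` (RTT), crux RSL_g `ResidualSignedLambdaLowerCMAtTwo` (stmt-BirchSwinnertonDyer-22608); seat `prover-bsd-wall-rtt-p2` g16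
(`--supports`, closes nothing). THEOREMS ONLY (an `∃`-statement with defining equations; no definition). The `ρ`-coefficient layer Tate
pairings of the tree (`CyclotomicLayer.rhoLayerPairingPk S ρ W ePk hμPk hadd₁Pk hadd₂Pk hgalPk Θ κ v hΘ n k`, `rhoLayerPairingAdic`) take as
DATA a family `ePk k : A_ρ[p^k] → A_ρ[p^k] → ℚ̄` with four properties (`p^k`-th roots of unity, bi-multiplicative, `Γ_ℚ`-equivariant). This
file CONSTRUCTS such a family from the alternating form on `T_ρ = 𝒪²` — `e_k(p^{-k}s, p^{-k}t) = ζ_k^{λ(s₀t₁ − s₁t₀) mod p^k}` for a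
compatible system `ζ_k` of `p^k`-th roots of unity and an additive `ℤ_p`-linear `λ : 𝒪 → ℤ_p` — and proves the four properties, the
`Γ_ℚ`-equivariance coming from **`det ρ = ε`** (landed for the crux's `ρ` from its Frobenius polynomials:
`ThetaTransport.det_eq_cyclotomicCharacter_of_frobCharpoly_shape`, p674333). So the datum `ePk` of the pin is KERNEL, not print
(pen 22:33:16Z: the `det ρ = ε` clause leaves the KZ_g HOLD). Perfectness (for `λ` an `𝒪`-generator of `Hom_{ℤ_p}(𝒪, ℤ_p)`) and the level
compatibility of the layer pairings are NOT here (items K-a2 / K-b). BSD is not proved by any of this.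

* `(Ms) ∧ (Mt) = det M · (s ∧ t)` on `𝒪²` (inline; the tree's `Rank1Residual.GaloisImage.cross_mulVec_mulVec`).
* `pow_eq_pow_val`, `pow_val_add`, `pow_val_mul` — exponent bookkeeping modulo `p^k` for `ζ^{p^k} = 1`.
* `exists_primitiveRoot_tower` — a compatible system of PRIMITIVE `p^k`-th roots of unity in `ℚ̄` (`ζ_{k+1}^p = ζ_k`).
* `det_eq_padicIntToCoeffIntegers_cyclotomicCharacter` — `det ρ = ε` inside `𝒪` from its `ℚ̄_p`-form.
* **`exists_cofreeWedgeTower`** — the family `ePk` with (hμ) (hadd₁) (hadd₂) (hgal) in EXACTLY the binder shapes of `rhoLayerPairingPk`, its value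
  formula on representatives, and the tower relation `e_{k+1}(a, b)^p = e_k(pa, pb)` on representatives.

References: [Kato2004Asterisque] §14.9 (p. 239) (`T*(1) ⊗ ℚ/ℤ ≅ A` for `V_𝒪(f)`); [Nekovar2006] §0.11; [DarmonDiamondTaylor1995] Thm. 3.1 (d).
-/

set_option autoImplicit false
-- the Theorems namespace of this sub repeats the summit name by design (D-0017 nested layout)
set_option linter.dupNamespace false

noncomputable section

open scoped Classical

namespace Summit.BirchSwinnertonDyer.BirchSwinnertonDyer.Theorems.ThetaTransport

open NumberField Field IsDedekindDomain Literature.NumberTheory.EllipticCurves Literature.NumberTheory.EllipticCurves.GreenbergSelmer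
  Literature.NumberTheory.GaloisRepresentations _root_.Matrix

/-! ## §1 Algebra: the alternating form and exponents modulo `p^k` -/

/-- `ζ^m = ζ^{(m mod N)}` read through `ZMod N`: if `ζ^N = 1` and `(m : ZMod N) = x` then `ζ^m = ζ^{x.val}`. [folklore]
[cite: Nekovar2006, §0.11] -/
theorem pow_eq_pow_val {K : Type*} [Monoid K] {N : ℕ} [NeZero N] {ζ : K} (hζ : ζ ^ N = 1) (x : ZMod N) (m : ℕ) (hm : (m : ZMod N) = x) :
    ζ ^ m = ζ ^ x.val := by
  rw [← hm, ZMod.val_natCast]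
  conv_lhs => rw [← Nat.mod_add_div m N, pow_add, pow_mul, hζ, one_pow, mul_one]

/-- `ζ^{(x+y).val} = ζ^{x.val} ζ^{y.val}` when `ζ^N = 1`. [folklore] [cite: Nekovar2006, §0.11] -/
theorem pow_val_add {K : Type*} [Monoid K] {N : ℕ} [NeZero N] {ζ : K} (hζ : ζ ^ N = 1) (x y : ZMod N) :
    ζ ^ (x + y).val = ζ ^ x.val * ζ ^ y.val := by
  rw [← pow_add, pow_eq_pow_val hζ (x + y) (x.val + y.val) (by rw [Nat.cast_add, ZMod.natCast_zmod_val, ZMod.natCast_zmod_val])]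

/-- `ζ^{(x*y).val} = (ζ^{x.val})^{y.val}` when `ζ^N = 1`. [folklore] [cite: Nekovar2006, §0.11] -/
theorem pow_val_mul {K : Type*} [Monoid K] {N : ℕ} [NeZero N] {ζ : K} (hζ : ζ ^ N = 1) (x y : ZMod N) :
    ζ ^ (x * y).val = (ζ ^ x.val) ^ y.val := by
  rw [← pow_mul, pow_eq_pow_val hζ (x * y) (x.val * y.val) (by rw [Nat.cast_mul, ZMod.natCast_zmod_val, ZMod.natCast_zmod_val])]

/-! ## §2 A compatible system of primitive `p^k`-th roots of unity in `ℚ̄` -/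

/-- **A compatible system of primitive `p`-power roots of unity in `ℚ̄`**: `ζ_k` primitive of order `p^k` with `ζ_{k+1}^p = ζ_k` (choose a
primitive `p`-th root, then successive `p`-th roots, which stay primitive). [folklore] [cite: Nekovar2006, §0.11] -/
theorem exists_primitiveRoot_tower (p : ℕ) [hp : Fact p.Prime] :
    ∃ ζ : ℕ → AlgebraicClosure ℚ, (∀ k, IsPrimitiveRoot (ζ k) (p ^ k)) ∧ ∀ k, ζ (k + 1) ^ p = ζ k := by
  haveI : NeZero (p : ℚ) := ⟨Nat.cast_ne_zero.mpr hp.out.ne_zero⟩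
  -- `T k` = primitive `p^(k+1)`-th roots; a base point and a successor map
  let T : ℕ → Type := fun k ↦ {z : AlgebraicClosure ℚ // IsPrimitiveRoot z (p ^ (k + 1))}
  have h0 : ∃ z : AlgebraicClosure ℚ, IsPrimitiveRoot z (p ^ (0 + 1)) := by
    rw [zero_add, pow_one]
    exact HasEnoughRootsOfUnity.exists_primitiveRoot (AlgebraicClosure ℚ) p
  have hstep : ∀ k (z : T k), ∃ x : AlgebraicClosure ℚ, x ^ p = z.1 ∧ IsPrimitiveRoot x (p ^ (k + 1 + 1)) := by
    intro k z
    obtain ⟨x, hx⟩ := IsAlgClosed.exists_pow_nat_eq z.1 hp.out.pos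
    refine ⟨x, hx, ?_, fun l hl ↦ ?_⟩
    · rw [pow_succ, pow_mul', hx]
      exact z.2.pow_eq_one
    · -- `η := x^{p^{k+1}} = z^{p^k}` is a primitive `p`-th root; `x^l = 1 ⇒ p^{k+1} ∣ l` and then `p ∣ l / p^{k+1}`
      have hz : IsPrimitiveRoot (x ^ p) (p ^ (k + 1)) := hx ▸ z.2
      have h1 : p ^ (k + 1) ∣ l := hz.dvd_of_pow_eq_one l (by rw [← pow_mul, mul_comm, pow_mul, hl, one_pow])
      obtain ⟨m, rfl⟩ := h1
      have hη : IsPrimitiveRoot (x ^ p ^ (k + 1)) p := by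
        have : x ^ p ^ (k + 1) = (x ^ p) ^ p ^ k := by rw [← pow_mul, pow_succ']
        rw [this]
        exact hz.pow (pow_pos hp.out.pos _) (pow_succ p k)
      have h2 : p ∣ m := hη.dvd_of_pow_eq_one m (by rw [← pow_mul, hl])
      obtain ⟨m', rfl⟩ := h2
      exact ⟨m', by ring⟩
  let ξ : ∀ k, T k := fun k ↦ Nat.rec (motive := T) ⟨h0.choose, h0.choose_spec⟩
    (fun k z ↦ ⟨(hstep k z).choose, (hstep k z).choose_spec.2⟩) k
  have hξ : ∀ k, (ξ (k + 1)).1 ^ p = (ξ k).1 := fun k ↦ (hstep k (ξ k)).choose_spec.1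
  refine ⟨fun k ↦ if k = 0 then 1 else (ξ (k - 1)).1, fun k ↦ ?_, fun k ↦ ?_⟩
  · rcases k with _ | k
    · simp
    · simpa using (ξ k).2
  · rcases k with _ | k
    · simpa using (ξ 0).2.pow_eq_one
    · simpa using hξ k

/-! ## §3 The tower `e_k` -/

variable {p : ℕ} [Fact p.Prime] (S : Set (PadicAlgCl p)) (ρ : FramedGaloisRep ℚ ↥(padicCoeffIntegers S) 2)

/-- `det ρ = ε` inside `𝒪` from the `ℚ̄_p`-form proved in `…DetCyclotomic.lean` (`𝒪 ⊂ ℚ̄_p` is injective; `padicIntToCoeffIntegers` is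
`ℤ_p ⊂ ℚ_p ⊂ ℚ̄_p` corestricted). [cite: DarmonDiamondTaylor1995, Thm. 3.1 (d)] -/
theorem det_eq_padicIntToCoeffIntegers_cyclotomicCharacter
    (hdet : ∀ σ : absoluteGaloisGroup ℚ, (((FramedRep.det ρ σ : (↥(padicCoeffIntegers S))ˣ) : ↥(padicCoeffIntegers S)) : PadicAlgCl p) =
      algebraMap ℚ_[p] (PadicAlgCl p) (((GaloisRep.cyclotomicCharacter ℚ p σ : ℤ_[p]ˣ) : ℤ_[p]) : ℚ_[p]))
    (σ : absoluteGaloisGroup ℚ) :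
    ((FramedRep.det ρ σ : (↥(padicCoeffIntegers S))ˣ) : ↥(padicCoeffIntegers S)) =
      padicIntToCoeffIntegers S ((GaloisRep.cyclotomicCharacter ℚ p σ : ℤ_[p]ˣ) : ℤ_[p]) :=
  Subtype.ext (by rw [hdet σ, coe_padicIntToCoeffIntegers])

set_option maxHeartbeats 400000 in
/-- **The self-duality tower of `ρ` (K-a).** Let `ρ : Γ_ℚ → GL₂(𝒪)` with `det ρ = ε` (in `𝒪`), `λ : 𝒪 →+ ℤ_p` additive and `ℤ_p`-linear,
and `ζ_k ∈ ℚ̄` with `ζ_k^{p^k} = 1`. Then there is a family `e_k : A_ρ[p^k] → A_ρ[p^k] → ℚ̄` with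
`e_k(p^{-k}s, p^{-k}t) = ζ_k^{(λ(s₀t₁ − s₁t₀) mod p^k)}` (value formula on representatives `s, t ∈ T_ρ = 𝒪²`, `T/p^k ≅ A[p^k]`), which is
`μ_{p^k}`-valued, bi-multiplicative and `Γ_ℚ`-EQUIVARIANT: `σ • e_k(a, b) = e_k(σa, σb)` — because `(ρ(σ)s) ∧ (ρ(σ)t) = det ρ(σ)·(s ∧ t) = ε(σ)(s ∧ t)`
and `σζ = ζ^{ε(σ)}`; these are exactly the data binders `(ePk, hμPk, hadd₁Pk, hadd₂Pk, hgalPk)` of `CyclotomicLayer.rhoLayerPairingPk`. If moreover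
`ζ_{k+1}^p = ζ_k` the family is a tower: `e_{k+1}(p^{-k-1}s, p^{-k-1}t)^p = e_k(p^{-k}s, p^{-k}t)`.
[cite: Kato2004Asterisque, §14.9 (p. 239)] [cite: Nekovar2006, §0.11] -/
theorem exists_cofreeWedgeTower
    (hdet : ∀ σ : absoluteGaloisGroup ℚ, ((FramedRep.det ρ σ : (↥(padicCoeffIntegers S))ˣ) : ↥(padicCoeffIntegers S)) =
      padicIntToCoeffIntegers S ((GaloisRep.cyclotomicCharacter ℚ p σ : ℤ_[p]ˣ) : ℤ_[p]))
    (lam : ↥(padicCoeffIntegers S) →+ ℤ_[p]) (hlam : ∀ (z : ℤ_[p]) (x : ↥(padicCoeffIntegers S)), lam (padicIntToCoeffIntegers S z * x) = z * lam x)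
    (ζ : ℕ → AlgebraicClosure ℚ) (hζ : ∀ k, ζ k ^ (p ^ k) = 1) :
    ∃ ePk : ∀ k : ℕ, ↥(AddSubgroup.torsionBy (Cofree ρ ↥(padicCoeffField S)) ((p ^ k : ℕ) : ℤ)) →
        ↥(AddSubgroup.torsionBy (Cofree ρ ↥(padicCoeffField S)) ((p ^ k : ℕ) : ℤ)) → AlgebraicClosure ℚ,
      (∀ k a b, ePk k a b ^ (p ^ k) = 1) ∧
      (∀ k a₁ a₂ b, ePk k (a₁ + a₂) b = ePk k a₁ b * ePk k a₂ b) ∧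
      (∀ k a b₁ b₂, ePk k a (b₁ + b₂) = ePk k a b₁ * ePk k a b₂) ∧
      (∀ k (σ : absoluteGaloisGroup ℚ) (a b : ↥(AddSubgroup.torsionBy (Cofree ρ ↥(padicCoeffField S)) ((p ^ k : ℕ) : ℤ))),
        σ • ePk k a b = ePk k (cofreeTorsionGaloisModule S ρ _ σ a) (cofreeTorsionGaloisModule S ρ _ σ b)) ∧
      (∀ k (s t : Fin 2 → ↥(padicCoeffIntegers S)),
        ePk k (divPowCofreeMkTorsion S ρ k s) (divPowCofreeMkTorsion S ρ k t) =
          ζ k ^ (PadicInt.toZModPow k (lam (s 0 * t 1 - s 1 * t 0))).val) ∧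
      ((∀ k, ζ (k + 1) ^ p = ζ k) → ∀ k (s t : Fin 2 → ↥(padicCoeffIntegers S)),
        ePk (k + 1) (divPowCofreeMkTorsion S ρ (k + 1) s) (divPowCofreeMkTorsion S ρ (k + 1) t) ^ p =
          ePk k (divPowCofreeMkTorsion S ρ k s) (divPowCofreeMkTorsion S ρ k t)) := by
  haveI : NeZero (p : ℚ) := ⟨Nat.cast_ne_zero.mpr (Fact.out : p.Prime).ne_zero⟩
  -- the exponent `val k s t = λ(s ∧ t) mod p^k` and its invariance under `s ↦ s + p^k s'`
  let val : ∀ k : ℕ, (Fin 2 → ↥(padicCoeffIntegers S)) → (Fin 2 → ↥(padicCoeffIntegers S)) → ZMod (p ^ k) :=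
    fun k s t ↦ PadicInt.toZModPow k (lam (s 0 * t 1 - s 1 * t 0))
  have hpk : ∀ k : ℕ, ((p : ↥(padicCoeffIntegers S))) ^ k = padicIntToCoeffIntegers S ((p : ℤ_[p]) ^ k) := fun k ↦ by
    rw [map_pow, map_natCast]
  have hkill : ∀ (k : ℕ) (c : ↥(padicCoeffIntegers S)), c ∈ Ideal.span {((p : ↥(padicCoeffIntegers S))) ^ k} →
      PadicInt.toZModPow k (lam c) = 0 := by
    intro k c hc
    obtain ⟨c', rfl⟩ := Ideal.mem_span_singleton'.mp hc
    rw [mul_comm, hpk, hlam, map_mul, map_pow, map_natCast, ← Nat.cast_pow, ZMod.natCast_self, zero_mul]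
  have hwd : ∀ (k : ℕ) (s s' t t' : Fin 2 → ↥(padicCoeffIntegers S)),
      divPowCofreeMk S ρ k s = divPowCofreeMk S ρ k s' → divPowCofreeMk S ρ k t = divPowCofreeMk S ρ k t' → val k s t = val k s' t' := by
    intro k s s' t t' hs ht
    rw [divPowCofreeMk_eq_iff] at hs ht
    have hdiff : (s 0 * t 1 - s 1 * t 0) - (s' 0 * t' 1 - s' 1 * t' 0) ∈ Ideal.span {((p : ↥(padicCoeffIntegers S))) ^ k} := by
      have : (s 0 * t 1 - s 1 * t 0) - (s' 0 * t' 1 - s' 1 * t' 0) =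
          (s 0 - s' 0) * t 1 - (s 1 - s' 1) * t 0 + s' 0 * (t 1 - t' 1) - s' 1 * (t 0 - t' 0) := by ring
      rw [this]
      refine Ideal.sub_mem _ (Ideal.add_mem _ (Ideal.sub_mem _ (Ideal.mul_mem_right _ _ (hs 0)) (Ideal.mul_mem_right _ _ (hs 1)))
        (Ideal.mul_mem_left _ _ (ht 1))) (Ideal.mul_mem_left _ _ (ht 0))
    have := hkill k _ hdiff
    rw [map_sub, map_sub, sub_eq_zero] at this
    exact this
  -- representatives and the family
  let rep : ∀ k : ℕ, ↥(AddSubgroup.torsionBy (Cofree ρ ↥(padicCoeffField S)) ((p ^ k : ℕ) : ℤ)) → (Fin 2 → ↥(padicCoeffIntegers S)) :=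
    fun k ↦ Function.surjInv (divPowCofreeMkTorsion_surjective S ρ k)
  have hrep : ∀ k a, divPowCofreeMkTorsion S ρ k (rep k a) = a := fun k ↦ Function.surjInv_eq (divPowCofreeMkTorsion_surjective S ρ k)
  let ePk : ∀ k : ℕ, ↥(AddSubgroup.torsionBy (Cofree ρ ↥(padicCoeffField S)) ((p ^ k : ℕ) : ℤ)) →
      ↥(AddSubgroup.torsionBy (Cofree ρ ↥(padicCoeffField S)) ((p ^ k : ℕ) : ℤ)) → AlgebraicClosure ℚ :=
    fun k a b ↦ ζ k ^ (val k (rep k a) (rep k b)).val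
  -- value formula on arbitrary representatives
  have hval : ∀ k (s t : Fin 2 → ↥(padicCoeffIntegers S)),
      ePk k (divPowCofreeMkTorsion S ρ k s) (divPowCofreeMkTorsion S ρ k t) = ζ k ^ (val k s t).val := by
    intro k s t
    change ζ k ^ (val k (rep k _) (rep k _)).val = _
    rw [hwd k (rep k (divPowCofreeMkTorsion S ρ k s)) s (rep k (divPowCofreeMkTorsion S ρ k t)) t
      (congrArg Subtype.val (hrep k (divPowCofreeMkTorsion S ρ k s))) (congrArg Subtype.val (hrep k (divPowCofreeMkTorsion S ρ k t)))]
  refine ⟨ePk, fun k a b ↦ ?_, fun k a₁ a₂ b ↦ ?_, fun k a b₁ b₂ ↦ ?_, fun k σ a b ↦ ?_, hval, fun hζsucc k s t ↦ ?_⟩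
  · -- (hμ)
    change (ζ k ^ _) ^ p ^ k = 1
    rw [← pow_mul, mul_comm, pow_mul, hζ k, one_pow]
  · -- (hadd₁)
    obtain ⟨s₁, rfl⟩ := divPowCofreeMkTorsion_surjective S ρ k a₁
    obtain ⟨s₂, rfl⟩ := divPowCofreeMkTorsion_surjective S ρ k a₂
    obtain ⟨t, rfl⟩ := divPowCofreeMkTorsion_surjective S ρ k b
    rw [← map_add, hval, hval, hval, ← pow_val_add (hζ k)]
    congr 2
    change PadicInt.toZModPow k (lam ((s₁ + s₂) 0 * t 1 - (s₁ + s₂) 1 * t 0)) =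
      PadicInt.toZModPow k (lam (s₁ 0 * t 1 - s₁ 1 * t 0)) + PadicInt.toZModPow k (lam (s₂ 0 * t 1 - s₂ 1 * t 0))
    rw [← map_add, ← map_add]
    congr 2
    simp only [Pi.add_apply]
    ring
  · -- (hadd₂)
    obtain ⟨s, rfl⟩ := divPowCofreeMkTorsion_surjective S ρ k a
    obtain ⟨t₁, rfl⟩ := divPowCofreeMkTorsion_surjective S ρ k b₁
    obtain ⟨t₂, rfl⟩ := divPowCofreeMkTorsion_surjective S ρ k b₂
    rw [← map_add, hval, hval, hval, ← pow_val_add (hζ k)]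
    congr 2
    change PadicInt.toZModPow k (lam (s 0 * (t₁ + t₂) 1 - s 1 * (t₁ + t₂) 0)) =
      PadicInt.toZModPow k (lam (s 0 * t₁ 1 - s 1 * t₁ 0)) + PadicInt.toZModPow k (lam (s 0 * t₂ 1 - s 1 * t₂ 0))
    rw [← map_add, ← map_add]
    congr 2
    simp only [Pi.add_apply]
    ring
  · -- (hgal): `σ • a = p^{-k}(ρ(σ)s)`, the wedge picks up `det ρ(σ) = ε(σ)`, and `σζ = ζ^{ε(σ)}`
    obtain ⟨s, rfl⟩ := divPowCofreeMkTorsion_surjective S ρ k a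
    obtain ⟨t, rfl⟩ := divPowCofreeMkTorsion_surjective S ρ k b
    set M : Matrix (Fin 2) (Fin 2) ↥(padicCoeffIntegers S) :=
      ((ρ σ : GL (Fin 2) ↥(padicCoeffIntegers S)) : Matrix (Fin 2) (Fin 2) ↥(padicCoeffIntegers S)) with hM
    have hσs : ∀ u : Fin 2 → ↥(padicCoeffIntegers S), cofreeTorsionGaloisModule S ρ _ σ (divPowCofreeMkTorsion S ρ k u) =
        divPowCofreeMkTorsion S ρ k (M *ᵥ u) := fun u ↦ by
      apply Subtype.ext
      rw [cofreeTorsionGaloisModule_apply_apply, AddSubgroup.torsionBy.coe_smul, coe_divPowCofreeMkTorsion_apply,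
        coe_divPowCofreeMkTorsion_apply, hM, divPowCofreeMk_smul]
    rw [hσs, hσs, hval, hval]
    -- the exponent of the right-hand side
    have hdetM : M.det = padicIntToCoeffIntegers S ((GaloisRep.cyclotomicCharacter ℚ p σ : ℤ_[p]ˣ) : ℤ_[p]) := by
      rw [← hdet σ, FramedRep.det_apply, Matrix.GeneralLinearGroup.val_det_apply]
    have hvalM : val k (M *ᵥ s) (M *ᵥ t) =
        PadicInt.toZModPow k ((GaloisRep.cyclotomicCharacter ℚ p σ : ℤ_[p]ˣ) : ℤ_[p]) * val k s t := by
      have hw : (M *ᵥ s) 0 * (M *ᵥ t) 1 - (M *ᵥ s) 1 * (M *ᵥ t) 0 = M.det * (s 0 * t 1 - s 1 * t 0) := by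
        simp only [Matrix.mulVec, dotProduct, Fin.sum_univ_two, Matrix.det_fin_two]
        ring
      change PadicInt.toZModPow k (lam ((M *ᵥ s) 0 * (M *ᵥ t) 1 - (M *ᵥ s) 1 * (M *ᵥ t) 0)) = _
      rw [hw, hdetM, hlam, map_mul]
    rw [hvalM, mul_comm, pow_val_mul (hζ k)]
    -- the left-hand side: `σ • ζ^v = (σ • ζ)^v = (ζ^{ε(σ) mod p^k})^v`
    rw [show σ • (ζ k ^ (val k s t).val) = (σ • ζ k) ^ (val k s t).val from
      map_pow (MulSemiringAction.toRingHom (absoluteGaloisGroup ℚ) (AlgebraicClosure ℚ) σ) (ζ k) (val k s t).val,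
      GaloisRep.cyclotomicCharacter_spec ℚ p σ (ζ k) (hζ k), ← pow_mul, ← pow_mul, mul_comm]
  · -- tower on representatives: `(ζ_{k+1}^{v_{k+1}})^p = ζ_k^{v_k}` with `v_{k+1} ≡ v_k (mod p^k)`
    rw [hval, hval, ← pow_mul, mul_comm, pow_mul, hζsucc k]
    refine pow_eq_pow_val (hζ k) (val k s t) _ ?_
    change ((PadicInt.toZModPow (k + 1) (lam (s 0 * t 1 - s 1 * t 0))).val : ZMod (p ^ k)) =
      PadicInt.toZModPow k (lam (s 0 * t 1 - s 1 * t 0))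
    rw [ZMod.natCast_val, ← PadicInt.zmod_cast_comp_toZModPow k (k + 1) (Nat.le_succ k)]
    rfl

end Summit.BirchSwinnertonDyer.BirchSwinnertonDyer.Theorems.ThetaTransport

end
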